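import Literature.MathematicalPhysics.QuantumLattice.PeriodicLayeredLatticeEnergyTransport
import Literature.MathematicalPhysics.QuantumLattice.HubbardStateSectorDecomposition
import Literature.MathematicalPhysics.QuantumLattice.HubbardFermionInteractionLocalHamiltonian
import Literature.MathematicalPhysics.QuantumLattice.HubbardHoppingFamilyLatticeSymmetry
import HarnessLib

/-!
# The period-2 stacking cell of a bilayer crystal reads the intra-bilayer pattern as ONE bond, and the
# on-site repulsion plus that bond is the Hubbard DIMER on `{0, e₀}`: bookkeeping identities for every state

Topic `Literature/MathematicalPhysics/QuantumLattice` (namespace = path; family `hubbard`). Sequel of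
`PeriodicLayeredLatticeEnergyTransport.lean` (period-`p+1` stacking on `ℤ^{d+1}`, views `periodicLayeredViews`, the
sublattice-selective vertical patterns from the layer classes) and the bookkeeping half of the U-DRESSED interlayer floor
(`PeriodicLayeredLatticeDimerDressedTransport.lean`, which turns these identities into the floor
`e_ρ(one-band, U − W) + ½(a + 2bρ) − |t⊥'|` from dimer rows `a + bk ≤ E₀(h_dimer(t⊥, W), k)`). Written for the S1/S2
interlayer seam of the Hubbard material-oracle programme (bilayer cuprates).

For the period-`2` stacking (`stackPeriods d 1`: the cell has the two points `0` and `e₀`), every state `ω` of the lattice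
fermions on `ℤ^{d+1}` and every range `R ≥ 1`:

* §1 `InfVolFermionState.meanEnergy_onSite_eq_mul_re_expect_docc`: `e_{Φ^{0,U}}(ω) = U·Re ω(n_{0↑}n_{0↓})` for EVERY state
  (no translation invariance — at `t = 0` the bond terms of the mean-energy observable vanish identically), the `U`-SPLIT of
  a one-band model `e_{Φ(U)}(ω) = e_{Φ(U−W)}(ω) + e_{Φ^{0,W}}(ω)` (`meanEnergy_vectorHoppingModel_eq_sub_add_onSite`), and
  `e_{Φ^{0,W}} = W·e_{Φ^{0,1}}`.
* §2 the two cell points (`exists_stackCells_two`), cell energy of constant views `½(e_Ψ(ω) + e_Ψ(ω ∘ τ_{e₀}))`, cell filling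
  `½(ρ(ω) + ρ(ω ∘ τ_{e₀}))`, translated one-site words (`re_expect_docc_shift`, `density_shift_eq`: `ω ∘ τ_v` reads at `0`
  what `ω` reads at `0 + v` — any `d`, any `v`), the re-centred bond `shift_expect_vectorHopping_pair_neg`
  (`(ω ∘ τ_v)(Γ Φ_v{−v, 0}) = ω(Φ_v{0, v})`), the coset test of the period-2 superlattice, and
  **`cellEnergy_intraPattern_stack_two`**: the cell energy of the unit vertical pattern from the EVEN layers is
  `K⊥(ω) = ½·Re ω(Φ^1_{e₀}{0, 0+e₀})` (the view from `0` sees the half-bond `{0, e₀}`, the view from `e₀`, read in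
  `ω ∘ τ_{e₀}`, sees the half-bond `{−e₀, 0}` — the same bond).
* §3 the Hubbard dimer on the region `{0, 0 + e₀}` (the local Hamiltonian `h` of the nearest-neighbour interaction `Φ^{s,W}` of
  `ℤ^{d+1}` there): `re_expect_localHamiltonian_pair` (`Re ω(h) = W·D_0 + W·D_{e₀} + s·Re ω(Φ^1_{e₀}{0,0+e₀})`),
  `re_expect_totalNumber_pair` (`Re ω(N) = ρ_0 + ρ_{e₀}`), `card_orb_polySite_pair` (`4` orbitals).

Everything is PROVED; no definition, no named fact, no number. HONEST SCOPE: identities of the state calculus only (no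
inequality of physical content is claimed here); the vertical vector is the unit layer step `e₀`.

## Tree / Mathlib search

REUSED: `stackPeriods`, `layerCoset`, `card_cell_stackPeriods` (`PeriodicLayeredLatticeEnergyTransport`); `vectorHoppingModel`,
`meanEnergy_vectorHoppingModel` (`LayeredLatticeEnergyTransport`); `cellEnergy`, `cellFilling` (`SuperlatticeCellEnergyFamilies`); `Cell`,
`cellPos`, `shift_zero`, `shift_expect`, `expect_fermionEmbed_incl_eq`, `compatible`, `fermionEmbed_fermionEmbed`, `nAt`
(`InfVolFermionState`, `PeriodicStatesCellAverage`); `sublatticeVectorHopping(_meanEnergyObs/_apply_pair)`, `sublatticeVectorHoppingViews`, `InCoset`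
(`SublatticeSelectiveInteractions`); `vectorHoppingFermionInteraction_apply_pair`, `fermionEmbed_vectorHopping_pair_eq` (`LatticeVectorHoppingInteraction`);
`hubbardFermionInteraction_meanEnergyObs/_apply_singleton/_apply_pair/_apply_eq_zero`, `meanEnergy_onSite_eq_one` (`HubbardFermionInteractionTerms`,
`HubbardHoppingFamilyLatticeSymmetry`); `FermionInteraction.localHamiltonian_eq_sum` (`HubbardFermionInteractionLocalHamiltonian`); `totalNumber`,
`fermionEmbed_numberOp`, `card_orb`, `card_polySite`; `fermionEmbed_nAt_of_apply_eq`. Mathlib: `Finset.sum_powerset_insert`, `Finset.powerset_empty`,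
`Finset.sum_pair`, `Finset.eq_univ_of_card`, `Fin.cons`, `Fin.cases`.
`lean search 'stack.*cell|docc_shift|density_shift|intraPattern' --decl` (QuantumLattice): nothing of this kind
(`LayerMarginalsAndPlaneStacks` computes densities of translated PLANE STACKS only).

## References

* H. Araki, H. Moriya, Rev. Math. Phys. 15 (2003) 93, §4.1 (periodic structure, translates `τ_k`), §5.1 (local Hamiltonians).
  [cite: ArakiMoriya2003, §4.1]
* O. Bratteli, A. Kishimoto, D. W. Robinson, CMP 64 (1978) 41, §3 (mean energy functional). [cite: BratteliKishimotoRobinson1978, §3 (mean energy functional)]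
* O. Bratteli, D. W. Robinson, *OAQSM 2* (1997), §6.2.4 (energy and particle number per site). [cite: BratteliRobinsonII1997, §6.2.4]
* E. Pavarini et al., PRL 87 (2001) 047003, eq. (1) (one-band models of layered cuprates, `t⊥`). [cite: PavariniEtAl2001, eq. (1)]
* E. H. Lieb, arXiv:cond-mat/9311033, §2 (the Hubbard Hamiltonian and its sectors). [cite: arXiv9311033, §2]
-/

noncomputable section

namespace Literature.MathematicalPhysics.QuantumLattice

open Matrix Finset HubbardWave0 Literature.Probability.LatticeModels ThermodynamicLimit
open scoped ComplexOrder BigOperators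

/-! ### §1. The on-site energy of an arbitrary state and the `U`-split of a one-band model -/

section OnSite

variable {d : ℕ} {ι : Type*} [Fintype ι]

/-- **`e_{Φ^{0,U}}(ω) = U · Re ω(n_{0↑}n_{0↓})` for EVERY state** (no translation invariance: at `t = 0` the bond
terms of the mean-energy observable vanish identically), every range parameter `R ≥ 1`.
[cite: BratteliKishimotoRobinson1978, §3 (mean energy functional)] -/
theorem InfVolFermionState.meanEnergy_onSite_eq_mul_re_expect_docc (ω : InfVolFermionState d) (U : ℝ) {R : ℝ}
    (hR : 1 ≤ R) :
    ω.meanEnergy (hubbardFermionInteraction d 0 U) R =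
      U * (ω.expect {0} (nAt (0 : Site d) (mem_singleton_self 0) 0 * nAt 0 (mem_singleton_self 0) 1)).re := by
  have hpair : ∀ (x : Site d) (i : Fin d), (hubbardFermionInteraction d 0 U).Φ {x, x + unitVec i} = 0 := fun x i => by
    rw [hubbardFermionInteraction_apply_pair, Complex.ofReal_zero, neg_zero, zero_smul]
  rw [ω.meanEnergy_onSite_eq_one U hR, InfVolFermionState.meanEnergy, hubbardFermionInteraction_meanEnergyObs,
    map_add, map_sum, Complex.add_re, Complex.re_sum]
  simp only [hpair, map_zero, smul_zero, add_zero, Complex.zero_re, Finset.sum_const_zero]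
  rw [hubbardFermionInteraction_apply_singleton, map_smul, map_smul, ω.compatible, smul_eq_mul, Complex.re_ofReal_mul]

/-- **THE `U`-SPLIT of a one-band model**: `e_{Φ(U)}(ω) = e_{Φ(U−W)}(ω) + W·Re ω(n_{0↑}n_{0↓})`, i.e.
`e_{Φ(U)}(ω) = e_{Φ(U−W)}(ω) + e_{Φ^{0,W}}(ω)`, for every state, all `U, W`, `R ≥ 1`. [cite: PavariniEtAl2001, eq. (1)] -/
theorem InfVolFermionState.meanEnergy_vectorHoppingModel_eq_sub_add_onSite (ω : InfVolFermionState d) (U W : ℝ)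
    (u : ι → Site d) (θ : ι → ℝ) {R : ℝ} (hR : 1 ≤ R) :
    ω.meanEnergy (vectorHoppingModel U u θ) R =
      ω.meanEnergy (vectorHoppingModel (U - W) u θ) R + ω.meanEnergy (hubbardFermionInteraction d 0 W) R := by
  rw [ω.meanEnergy_vectorHoppingModel, ω.meanEnergy_vectorHoppingModel, ω.meanEnergy_onSite_eq_mul_re_expect_docc U hR,
    ω.meanEnergy_onSite_eq_mul_re_expect_docc (U - W) hR, ω.meanEnergy_onSite_eq_mul_re_expect_docc W hR]
  ring

/-- The on-site energy scales with the coupling: `e_{Φ^{0,W}}(ω) = W · e_{Φ^{0,1}}(ω)` (every state, `R ≥ 1`).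
[cite: BratteliKishimotoRobinson1978, §3 (mean energy functional)] -/
theorem InfVolFermionState.meanEnergy_onSite_eq_mul_one (ω : InfVolFermionState d) (W : ℝ) {R : ℝ} (hR : 1 ≤ R) :
    ω.meanEnergy (hubbardFermionInteraction d 0 W) R = W * ω.meanEnergy (hubbardFermionInteraction d 0 1) R := by
  rw [ω.meanEnergy_onSite_eq_mul_re_expect_docc W hR, ω.meanEnergy_onSite_eq_mul_re_expect_docc 1 hR, one_mul]

end OnSite

/-! ### §2. The period-`2` stacking cell: two cell points, translated one-site words, the intra-bilayer pattern -/

section StackTwo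

variable {d : ℕ}

/-- **The period-`2` stacking cell has exactly the two points `0` and `e₀`.** [cite: ArakiMoriya2003, §4.1] -/
theorem exists_stackCells_two :
    ∃ c₀ c₁ : Cell (stackPeriods d 1), c₀ ≠ c₁ ∧ (Finset.univ : Finset (Cell (stackPeriods d 1))) = {c₀, c₁} ∧
      cellPos c₀ = 0 ∧ cellPos c₁ = unitVec 0 := by
  have h1 : 1 < stackPeriods d 1 0 + 1 := by simp [stackPeriods]
  let c₀ : Cell (stackPeriods d 1) := fun _ => 0
  let c₁ : Cell (stackPeriods d 1) :=
    Fin.cons (α := fun i : Fin (d + 1) => Fin (stackPeriods d 1 i + 1)) ⟨1, h1⟩ fun _ => 0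
  have hne : c₀ ≠ c₁ := by
    intro h
    have h0 := congrArg (fun c : Cell (stackPeriods d 1) => ((c 0 : ℕ))) h
    simp only [c₀, c₁, Fin.cons_zero, Fin.val_zero] at h0
    exact absurd h0 (by norm_num)
  refine ⟨c₀, c₁, hne, ?_, ?_, ?_⟩
  · symm
    refine Finset.eq_univ_of_card _ ?_
    rw [Finset.card_pair hne, card_cell_stackPeriods]
  · funext i
    simp [cellPos, c₀]
  · funext i
    refine Fin.cases ?_ (fun j => ?_) i
    · simp [cellPos, c₁, unitVec]
    · simp [cellPos, c₁, unitVec, Fin.succ_ne_zero]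

/-- **Cell energy of constant views over the period-`2` stacking cell**: `e_{(Ψ)}(ω) = ½(e_Ψ(ω) + e_Ψ(ω ∘ τ_{e₀}))`.
[cite: BratteliKishimotoRobinson1978, §3 (mean energy functional)] -/
theorem InfVolFermionState.cellEnergy_const_stack_two (Ψ : FermionInteraction (d + 1)) (R : ℝ)
    (ω : InfVolFermionState (d + 1)) :
    ω.cellEnergy (fun _ : Cell (stackPeriods d 1) => Ψ) R =
      2⁻¹ * (ω.meanEnergy Ψ R + (ω.shift (unitVec 0)).meanEnergy Ψ R) := by
  obtain ⟨c₀, c₁, hne, huniv, h0, h1⟩ := exists_stackCells_two (d := d)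
  rw [InfVolFermionState.cellEnergy, card_cell_stackPeriods, Nat.cast_add, Nat.cast_one, one_add_one_eq_two, huniv,
    Finset.sum_pair hne, h0, h1, InfVolFermionState.shift_zero]

/-- **Cell filling over the period-`2` stacking cell**: `ρ̄(ω) = ½(ρ(ω) + ρ(ω ∘ τ_{e₀}))`. [cite: ArakiMoriya2003, §4.1] -/
theorem InfVolFermionState.cellFilling_stack_two (ω : InfVolFermionState (d + 1)) :
    ω.cellFilling (stackPeriods d 1) = 2⁻¹ * (ω.density + (ω.shift (unitVec 0)).density) := by
  obtain ⟨c₀, c₁, hne, huniv, h0, h1⟩ := exists_stackCells_two (d := d)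
  rw [InfVolFermionState.cellFilling, card_cell_stackPeriods, Nat.cast_add, Nat.cast_one, one_add_one_eq_two, huniv,
    Finset.sum_pair hne, h0, h1, InfVolFermionState.shift_zero]

/-- **Translated double occupancy**: `Re (ω ∘ τ_v)(n_{0↑}n_{0↓}) = Re ω(n_{v↑}n_{v↓})` (read on the region `{0 + v}`).
[cite: ArakiMoriya2003, §4.1 eq. (4.11)] -/
theorem InfVolFermionState.re_expect_docc_shift (ω : InfVolFermionState d) (v : Site d) :
    ((ω.shift v).expect {0} (nAt (0 : Site d) (mem_singleton_self 0) 0 * nAt 0 (mem_singleton_self 0) 1)).re =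
      (ω.expect {0 + v} (nAt (0 + v) (mem_singleton_self _) 0 * nAt (0 + v) (mem_singleton_self _) 1)).re := by
  rw [InfVolFermionState.shift_expect]
  congr 1
  refine ω.expect_fermionEmbed_incl_eq subset_union_left subset_union_right _ _ ?_
  rw [map_mul, map_mul, map_mul, fermionEmbed_fermionEmbed, fermionEmbed_fermionEmbed]
  have hmem : (0 + v : Site d) ∈ shiftSet v ({0} : Finset (Site d)) ∪ {0 + v} :=
    mem_union_right _ (mem_singleton_self _)
  have h1 : ∀ σ, fermionEmbed ((PolySite.shiftEmb v ({0} : Finset (Site d))).trans (PolySite.incl subset_union_left))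
      (nAt (0 : Site d) (mem_singleton_self 0) σ) = nAt (0 + v) hmem σ := fun σ =>
    fermionEmbed_nAt_of_apply_eq _ _ hmem (by simp) σ
  have h2 : ∀ σ, fermionEmbed (PolySite.incl (subset_union_right (s₁ := shiftSet v ({0} : Finset (Site d)))))
      (nAt (0 + v) (mem_singleton_self (0 + v)) σ) = nAt (0 + v) hmem σ := fun σ =>
    fermionEmbed_nAt_of_apply_eq _ _ hmem (by simp) σ
  rw [h1, h1, h2, h2]

/-- **Translated density**: `ρ(ω ∘ τ_v) = ρ_v(ω)` (read on the region `{0 + v}`). [cite: ArakiMoriya2003, §4.1 eq. (4.11)] -/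
theorem InfVolFermionState.density_shift_eq (ω : InfVolFermionState d) (v : Site d) :
    (ω.shift v).density =
      (ω.expect {0 + v} (nAt (0 + v) (mem_singleton_self _) 0 + nAt (0 + v) (mem_singleton_self _) 1)).re := by
  rw [InfVolFermionState.density, InfVolFermionState.densityAt, InfVolFermionState.shift_expect]
  congr 1
  refine ω.expect_fermionEmbed_incl_eq subset_union_left subset_union_right _ _ ?_
  rw [map_add, map_add, map_add, fermionEmbed_fermionEmbed, fermionEmbed_fermionEmbed]
  have hmem : (0 + v : Site d) ∈ shiftSet v ({0} : Finset (Site d)) ∪ {0 + v} :=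
    mem_union_right _ (mem_singleton_self _)
  have h1 : ∀ σ, fermionEmbed ((PolySite.shiftEmb v ({0} : Finset (Site d))).trans (PolySite.incl subset_union_left))
      (nAt (0 : Site d) (mem_singleton_self 0) σ) = nAt (0 + v) hmem σ := fun σ =>
    fermionEmbed_nAt_of_apply_eq _ _ hmem (by simp) σ
  have h2 : ∀ σ, fermionEmbed (PolySite.incl (subset_union_right (s₁ := shiftSet v ({0} : Finset (Site d)))))
      (nAt (0 + v) (mem_singleton_self (0 + v)) σ) = nAt (0 + v) hmem σ := fun σ =>
    fermionEmbed_nAt_of_apply_eq _ _ hmem (by simp) σ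
  rw [h1, h1, h2, h2]

/-- **Re-centring the bond behind the origin**: the translated state reads the embedded bond `{−v, 0}` as `ω` reads
the bond `{0, v}`: `(ω ∘ τ_v)(Γ Φ_v{−v, −v+v}) = ω(Φ_v{0, 0+v})`. [cite: ArakiMoriya2003, §4.1 eq. (4.11)] -/
theorem InfVolFermionState.shift_expect_vectorHopping_pair_neg (ω : InfVolFermionState d) {v : Site d} (hv : v ≠ 0)
    (t : ℝ) {R : ℝ} (hvR : v ∈ thicken ({0} : Finset (Site d)) R) :
    (ω.shift v).expect (thicken ({0} : Finset (Site d)) R)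
        (fermionEmbed (PolySite.incl (pair_neg_subset_thicken_zero hvR))
          ((vectorHoppingFermionInteraction d v t).Φ {-v, -v + v})) =
      ω.expect {0, 0 + v} ((vectorHoppingFermionInteraction d v t).Φ {0, 0 + v}) := by
  rw [InfVolFermionState.shift_expect, fermionEmbed_fermionEmbed]
  refine ω.expect_fermionEmbed_incl_eq subset_union_left subset_union_right _ _ ?_
  rw [fermionEmbed_fermionEmbed]
  refine fermionEmbed_vectorHopping_pair_eq t hv hv (-v) 0 _ _ ?_ ?_
  · simp
  · simp

/-- In the period-`2` stacking superlattice only the layer coordinate is read: `x ∈ coset(c) ↔ 2 ∣ (x₀ − c₀)`.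
[cite: ArakiMoriya2003, §4.1] -/
theorem inCoset_stackPeriods_one_iff (c x : Site (d + 1)) :
    InCoset (stackPeriods d 1) c x ↔ (x 0 - c 0) % 2 = 0 := by
  constructor
  · intro h
    simpa [stackPeriods] using h 0
  · intro h i
    refine Fin.cases ?_ (fun j => ?_) i
    · simpa [stackPeriods] using h
    · simp [stackPeriods, Fin.succ_ne_zero]

/-- The layer-`0` coset representative is the origin. [cite: ArakiMoriya2003, §4.1] -/
theorem layerCoset_zero_eq (d : ℕ) : layerCoset d 0 = 0 := by
  funext i
  refine Fin.cases ?_ (fun j => ?_) i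
  · simp [layerCoset]
  · simp [layerCoset]

/-- **THE INTRA-BILAYER PATTERN READS ONE BOND.** Over the period-`2` stacking cell, the cell energy of the
sublattice-selective vertical hopping from the EVEN layers (unit amplitude) is half the `{0, e₀}` bond energy of the
state: `K⊥(ω) = ½ · Re ω(Φ^1_{e₀}{0, 0 + e₀})` — the view from `0` sees the half-bond `{0, e₀}`, the view from `e₀`
(read in `ω ∘ τ_{e₀}`) sees the half-bond `{−e₀, 0}`, which is the same bond. [cite: PavariniEtAl2001, eq. (1)] -/
theorem InfVolFermionState.cellEnergy_intraPattern_stack_two (ω : InfVolFermionState (d + 1)) {R : ℝ} (hR : 1 ≤ R) :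
    ω.cellEnergy (sublatticeVectorHoppingViews (stackPeriods d 1) (layerCoset d 0) (unitVec 0) 1) R =
      2⁻¹ * (ω.expect {0, 0 + unitVec 0}
        ((vectorHoppingFermionInteraction (d + 1) (unitVec 0) 1).Φ {0, 0 + unitVec 0})).re := by
  obtain ⟨c₀, c₁, hne, huniv, h0, h1⟩ := exists_stackCells_two (d := d)
  have hv : (unitVec (0 : Fin (d + 1)) : Site (d + 1)) ≠ 0 := uvec_ne_zero 0
  have hvR : (unitVec (0 : Fin (d + 1)) : Site (d + 1)) ∈ thicken ({0} : Finset (Site (d + 1))) R :=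
    thicken_mono _ hR (unitVec_mem_thicken_one 0)
  set B : ℂ := ω.expect {0, 0 + unitVec 0}
    ((vectorHoppingFermionInteraction (d + 1) (unitVec 0) 1).Φ {0, 0 + unitVec 0}) with hB
  have h2inv : (2 : ℂ)⁻¹ = ((2⁻¹ : ℝ) : ℂ) := by rw [Complex.ofReal_inv, Complex.ofReal_ofNat]
  -- the coset tests of the two views
  have hc00 : InCoset (stackPeriods d 1) (layerCoset d 0 - 0) 0 := by
    rw [inCoset_stackPeriods_one_iff, layerCoset_zero_eq]; simp
  have hc01 : ¬ InCoset (stackPeriods d 1) (layerCoset d 0 - 0) (-unitVec 0) := by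
    rw [inCoset_stackPeriods_one_iff, layerCoset_zero_eq]; simp [unitVec]
  have hc10 : ¬ InCoset (stackPeriods d 1) (layerCoset d 0 - unitVec 0) 0 := by
    rw [inCoset_stackPeriods_one_iff, layerCoset_zero_eq]; simp [unitVec]
  have hc11 : InCoset (stackPeriods d 1) (layerCoset d 0 - unitVec 0) (-unitVec 0) := by
    rw [inCoset_stackPeriods_one_iff, layerCoset_zero_eq]; simp [unitVec]
  -- view from `0`, read in `ω`
  have e0 : ω.meanEnergy (sublatticeVectorHopping (stackPeriods d 1) (layerCoset d 0 - 0) (unitVec 0) 1) R =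
      2⁻¹ * B.re := by
    rw [InfVolFermionState.meanEnergy, sublatticeVectorHopping_meanEnergyObs (stackPeriods d 1) _ hv 1 hvR,
      sublatticeVectorHopping_apply_pair _ _ hv 1 0, sublatticeVectorHopping_apply_pair _ _ hv 1 (-unitVec 0),
      if_pos hc00, if_neg hc01, map_zero, smul_zero, add_zero, map_smul, ω.compatible, smul_eq_mul, h2inv,
      Complex.re_ofReal_mul]
  -- view from `e₀`, read in `ω ∘ τ_{e₀}`
  have e1 : (ω.shift (unitVec 0)).meanEnergy
      (sublatticeVectorHopping (stackPeriods d 1) (layerCoset d 0 - unitVec 0) (unitVec 0) 1) R = 2⁻¹ * B.re := by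
    rw [InfVolFermionState.meanEnergy, sublatticeVectorHopping_meanEnergyObs (stackPeriods d 1) _ hv 1 hvR,
      sublatticeVectorHopping_apply_pair _ _ hv 1 0, sublatticeVectorHopping_apply_pair _ _ hv 1 (-unitVec 0),
      if_neg hc10, if_pos hc11, map_zero, smul_zero, zero_add, map_smul,
      ω.shift_expect_vectorHopping_pair_neg hv 1 hvR, smul_eq_mul, h2inv, Complex.re_ofReal_mul]
  rw [InfVolFermionState.cellEnergy, card_cell_stackPeriods, Nat.cast_add, Nat.cast_one, one_add_one_eq_two, huniv,
    Finset.sum_pair hne]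
  simp only [sublatticeVectorHoppingViews]
  rw [h0, h1, InfVolFermionState.shift_zero, e0, e1]
  ring

end StackTwo

/-! ### §3. The Hubbard dimer on the region `{0, e₀}`: its expectation and its particle number in a state -/

section Dimer

variable {d : ℕ}

/-- The empty set carries no Hubbard term. [cite: arXiv9311033, §2 (the Hubbard Hamiltonian)] -/
theorem hubbardFermionInteraction_apply_empty (t U : ℝ) : (hubbardFermionInteraction d t U).Φ ∅ = 0 :=
  hubbardFermionInteraction_apply_eq_zero t U (fun x => (singleton_ne_empty x).symm)
    (fun x _ => (insert_ne_empty x _).symm)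

/-- Sum over the subsets of a singleton: `Σ_{T ⊆ {x}} f T = f ∅ + f {x}`. [folklore] -/
private theorem sum_powerset_singleton_eq {α M : Type*} [DecidableEq α] [AddCommMonoid M] (x : α) (f : Finset α → M) :
    ∑ T ∈ ({x} : Finset α).powerset, f T = f ∅ + f {x} := by
  rw [← Finset.insert_empty, Finset.sum_powerset_insert (Finset.notMem_empty x), Finset.powerset_empty,
    Finset.sum_singleton, Finset.sum_singleton, Finset.insert_empty]

/-- **The dimer's energy in a state**: on the region `{0, 0 + v}`, `v = e₀`, the local Hamiltonian `h` of the
nearest-neighbour Hubbard interaction `Φ^{s,W}` of `ℤ^{d+1}` satisfies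
`Re ω(h) = W·Re ω(n_{0↑}n_{0↓}) + W·Re ω(n_{v↑}n_{v↓}) + s·Re ω(Φ^1_{v}{0, 0+v})` (every state).
[cite: ArakiMoriya2003, §5.1 (local Hamiltonian H(I))] -/
theorem InfVolFermionState.re_expect_localHamiltonian_pair (ω : InfVolFermionState (d + 1)) (s W : ℝ) :
    (ω.expect {0, 0 + unitVec 0} ((hubbardFermionInteraction (d + 1) s W).localHamiltonian {0, 0 + unitVec 0})).re =
      W * (ω.expect {0} (nAt (0 : Site (d + 1)) (mem_singleton_self 0) 0 * nAt 0 (mem_singleton_self 0) 1)).re +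
        W * (ω.expect {0 + unitVec 0} (nAt (0 + unitVec 0 : Site (d + 1)) (mem_singleton_self _) 0 *
          nAt (0 + unitVec 0) (mem_singleton_self _) 1)).re +
        s * (ω.expect {0, 0 + unitVec 0}
          ((vectorHoppingFermionInteraction (d + 1) (unitVec 0) 1).Φ {0, 0 + unitVec 0})).re := by
  have hv : (unitVec (0 : Fin (d + 1)) : Site (d + 1)) ≠ 0 := uvec_ne_zero 0
  -- the expectation of the local Hamiltonian is the sum of the term energies
  have hsum : ω.expect {0, 0 + unitVec 0} ((hubbardFermionInteraction (d + 1) s W).localHamiltonian {0, 0 + unitVec 0}) =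
      ∑ X ∈ ({0, 0 + unitVec 0} : Finset (Site (d + 1))).powerset,
        ω.expect X ((hubbardFermionInteraction (d + 1) s W).Φ X) := by
    rw [(hubbardFermionInteraction (d + 1) s W).localHamiltonian_eq_sum, map_sum]
    refine Finset.sum_congr rfl fun X hX => ?_
    rw [Finset.mem_powerset] at hX
    rw [dif_pos hX, ω.compatible hX]
  have hnot : (0 : Site (d + 1)) ∉ ({0 + unitVec 0} : Finset (Site (d + 1))) := by
    rw [mem_singleton]; exact self_ne_add_of_ne_zero 0 hv
  rw [hsum, Finset.sum_powerset_insert hnot, sum_powerset_singleton_eq, sum_powerset_singleton_eq,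
    Finset.insert_empty, hubbardFermionInteraction_apply_empty, map_zero, zero_add,
    hubbardFermionInteraction_apply_singleton, hubbardFermionInteraction_apply_singleton,
    hubbardFermionInteraction_apply_pair, vectorHoppingFermionInteraction_apply_pair hv, map_smul, map_smul, map_smul,
    map_smul]
  simp only [Complex.add_re, smul_eq_mul, Complex.re_ofReal_mul, neg_mul, Complex.neg_re, Complex.ofReal_one, one_mul]
  ring

/-- **The dimer's particle number in a state**: `Re ω(N_{{0, 0+v}}) = ρ_0(ω) + ρ_v(ω)` (`v = e₀`; every state).
[cite: BratteliRobinsonII1997, §6.2.4] -/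
theorem InfVolFermionState.re_expect_totalNumber_pair (ω : InfVolFermionState (d + 1)) :
    (ω.expect {0, 0 + unitVec 0} (totalNumber : FermionOp ({0, 0 + unitVec 0} : Finset (Site (d + 1))))).re =
      ω.density + (ω.expect {0 + unitVec 0} (nAt (0 + unitVec 0 : Site (d + 1)) (mem_singleton_self _) 0 +
        nAt (0 + unitVec 0) (mem_singleton_self _) 1)).re := by
  have hv : (unitVec (0 : Fin (d + 1)) : Site (d + 1)) ≠ 0 := uvec_ne_zero 0
  set Λ : Finset (Site (d + 1)) := {0, 0 + unitVec 0} with hΛ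
  let e : PolySite Λ ≃ {x // x ∈ Λ} :=
    ⟨fun a => ⟨ofLex a.1, PolySite.ofLex_mem a⟩, fun x => PolySite.pt x.1 x.2, fun a => PolySite.pt_ofLex a,
      fun x => Subtype.ext rfl⟩
  have hsum : (totalNumber : FermionOp Λ) =
      ∑ x ∈ Λ.attach, (numberOp (PolySite.pt x.1 x.2) 0 + numberOp (PolySite.pt x.1 x.2) 1) := by
    rw [totalNumber, ← Finset.univ_eq_attach]
    refine Fintype.sum_equiv e _ _ fun a => ?_
    rw [Fin.sum_univ_two, show PolySite.pt (e a).1 (e a).2 = e.symm (e a) from rfl, Equiv.symm_apply_apply]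
  have hterm : ∀ x : {x // x ∈ Λ},
      (ω.expect Λ (numberOp (PolySite.pt x.1 x.2) 0 + numberOp (PolySite.pt x.1 x.2) 1)).re =
        (ω.expect {x.1} (nAt x.1 (mem_singleton_self x.1) 0 + nAt x.1 (mem_singleton_self x.1) 1)).re := by
    intro x
    have hcomp : ∀ σ : Fin 2, ω.expect Λ (numberOp (PolySite.pt x.1 x.2) σ) =
        ω.expect {x.1} (nAt x.1 (mem_singleton_self x.1) σ) := by
      intro σ
      rw [← ω.compatible (singleton_subset_iff.2 x.2) (nAt x.1 (mem_singleton_self x.1) σ), nAt,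
        fermionEmbed_numberOp, PolySite.incl_pt]
    rw [map_add, hcomp, hcomp, ← map_add]
  rw [hsum, map_sum, Complex.re_sum, Finset.sum_congr rfl fun x _ => hterm x,
    Finset.sum_attach Λ (fun x => (ω.expect {x} (nAt x (mem_singleton_self x) 0 + nAt x (mem_singleton_self x) 1)).re),
    hΛ, Finset.sum_pair (self_ne_add_of_ne_zero 0 hv)]
  rfl

/-- The region `{0, 0 + e₀}` has `2` ordered sites and `4` orbitals (the dimer's Fock space has the sectors `N ≤ 4`).
[cite: arXiv9311033, §2] -/
theorem card_orb_polySite_pair :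
    Fintype.card (Orb (PolySite ({0, 0 + unitVec 0} : Finset (Site (d + 1))))) = 4 := by
  rw [card_orb, card_polySite, card_pair (self_ne_add_of_ne_zero 0 (uvec_ne_zero 0))]

end Dimer

end Literature.MathematicalPhysics.QuantumLattice

end
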